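import Summits.AtomisticToContinuum.Crystallization.Theorems.FrustratedLawDichotomyStrainedPatchHomTermEval

/-!
# Reflected per-term VALUE and DERIVATIVE checks at the leaf centre, on the tree's fixed-point interval kernel (CERT-DESIGN-g44 §9 D3)

decomp-a2c hand-2 g21, companion of `…StrainedPatchHomTermEval` (crux `AperiodicFrustratedLawGap`, stmt-AtomisticToContinuum-27623).  The checker
inequality `hcheck` of `…HomCentredForm.leaf_sound_box` needs, per lattice term, a LOWER bound of the value `φ(q₀)` and a TWO-SIDED enclosure of the
derivative `φ′(q₀)` at the (dyadic) leaf centre `q₀ = q0/SC`.  Here, on `Literature.Analysis.ValidatedNumerics.Numerics.FI` (scale `SC = 2^48`):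

* ★ `valLoOK q0 V : Bool` with `valLoOK_sound : … = true → V/SC ≤ φ(q0/SC)`;
* ★ `derivOK q0 Dlo Dhi : Bool` with `derivOK_sound : … = true → φ′(q0/SC) ∈ Icc (Dlo/SC) (Dhi/SC)`,

`φ(q) = W₄₅(√q)`, `φ′(q) = W₄₅′(√q)/(2√q)`; regime of `q₀` by integer comparison with `64/25, 9, 81/4`; inside a regime the bounds are the tree lemmas of
`…TermCalculusSq` (pure-LJ / far: exact rational forms) and `…TermPointBounds` (window: affine-decreasing value + termwise monomials; bump: even/odd split
with the two endpoint tests), evaluated in `FI` with `√q₀ ∈ [(FI.sqrt Q).lo, (FI.sqrt Q).hi]/SC`.  The record's `V`, `Dlo`, `Dhi` are HINTS; the kernel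
recomputes and compares.  Computable; `decide +kernel` smoke tests at the end.  0 sorry; standard axioms.  `--supports stmt-AtomisticToContinuum-27623`.
-/

namespace Summit.AtomisticToContinuum.Crystallization.Theorems.FrustratedLawDichotomyStrainedPatchHomTermEvalPoint

open Set
open Literature.Analysis.ValidatedNumerics.Numerics
open Summit.AtomisticToContinuum.Crystallization.Theorems.FrustratedLawDichotomySchurCut (effPot w₄₅ ω₄)
open Summit.AtomisticToContinuum.Crystallization.Theorems.FrustratedLawDichotomyStrainedPatchHomTermCalculusSq
open Summit.AtomisticToContinuum.Crystallization.Theorems.FrustratedLawDichotomyStrainedPatchHomTermPointBounds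
open Summit.AtomisticToContinuum.Crystallization.Theorems.FrustratedLawDichotomyStrainedPatchHomTermEval

/-! ## §1. `FI` enclosures of the regime formulas at a point -/

/-- `V(q) = q⁻⁶/12 − q⁻³/6` from `Q ∋ q`. -/
def eVq (Q : FI) : FI := FI.sub (mulRat (npow (invPos Q) 6) 1 12) (mulRat (npow (invPos Q) 3) 1 6)

/-- `G(q) = −q⁻⁷/2 + q⁻⁴/2` (the pure-LJ `φ′`) from `Q ∋ q`. -/
def eGlj (Q : FI) : FI := FI.sub (mulRat (npow (invPos Q) 4) 1 2) (mulRat (npow (invPos Q) 7) 1 2)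

/-- Inclusion for `eVq`. [folklore] -/
theorem mem_eVq {q : ℝ} {Q : FI} (hq : FI.mem q Q) (hQ : 0 < Q.lo) : FI.mem (1 / 12 * q⁻¹ ^ 6 - 1 / 6 * q⁻¹ ^ 3) (eVq Q) := by
  have hI := mem_invPos hq hQ
  have h := FI.mem_sub (mem_mulRat (mem_npow hI 6) 1 (q := 12) (by norm_num)) (mem_mulRat (mem_npow hI 3) 1 (q := 6) (by norm_num))
  exact mem_congr h (by push_cast; ring)

/-- Inclusion for `eGlj`. [folklore] -/
theorem mem_eGlj {q : ℝ} {Q : FI} (hq : FI.mem q Q) (hQ : 0 < Q.lo) : FI.mem (-(1 / 2) * q⁻¹ ^ 7 + 1 / 2 * q⁻¹ ^ 4) (eGlj Q) := by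
  have hI := mem_invPos hq hQ
  have h := FI.mem_sub (mem_mulRat (mem_npow hI 4) 1 (q := 2) (by norm_num)) (mem_mulRat (mem_npow hI 7) 1 (q := 2) (by norm_num))
  exact mem_congr h (by push_cast; ring)

/-- Window value lower-bound expression `V(q)·((16q + 648)·hi − 180q − 729)/27` from `Q ∋ q` and the scaled upper root `S2 = hi·SC`. -/
def eWinVal (Q : FI) (S2 : ℤ) : FI :=
  FI.mul (eVq Q) (mulRat (FI.sub (FI.sub (FI.mul (FI.add (FI.mulInt Q 16) (FI.ofInt 648)) (FI.ofScaled S2)) (FI.mulInt Q 180)) (FI.ofInt 729)) 1 27)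

/-- Inclusion for `eWinVal`. [folklore] -/
theorem mem_eWinVal {q : ℝ} {Q : FI} {S2 : ℤ} (hq : FI.mem q Q) (hQ : 0 < Q.lo) :
    FI.mem ((1 / 12 * q⁻¹ ^ 6 - 1 / 6 * q⁻¹ ^ 3) * (((16 * q + 648) * ((S2 : ℝ) / SC) - 180 * q - 729) / 27)) (eWinVal Q S2) := by
  have h1 := FI.mem_add (FI.mem_mulInt hq 16) (FI.mem_ofInt 648)
  have h2 := FI.mem_mul h1 (FI.mem_ofScaled S2)
  have h3 := FI.mem_sub (FI.mem_sub h2 (FI.mem_mulInt hq 180)) (FI.mem_ofInt 729)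
  have h4 := mem_mulRat h3 1 (q := 27) (by norm_num)
  have h := FI.mem_mul (mem_eVq hq hQ) h4
  exact mem_congr h (by push_cast; ring)

/-- Window derivative bound expression (lower with `(T, U) = (hi, lo)`, upper with `(T, U) = (lo, hi)`):
`(27/2)T⁻¹⁴ − 11U⁻¹³ + (25/9)T⁻¹² − (2/9)U⁻¹¹ − (27/2)U⁻⁸ + 10T⁻⁷ − (20/9)U⁻⁶ + (4/27)T⁻⁵` from scaled `ST = T·SC`, `SU = U·SC`. -/
def eWinDer (ST SU : ℤ) : FI :=
  let T := invPos (FI.ofScaled ST)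
  let U := invPos (FI.ofScaled SU)
  FI.add (FI.sub (FI.add (FI.sub (FI.sub (FI.add (FI.sub (mulRat (npow T 14) 27 2) (FI.mulInt (npow U 13) 11)) (mulRat (npow T 12) 25 9))
    (mulRat (npow U 11) 2 9)) (mulRat (npow U 8) 27 2)) (FI.mulInt (npow T 7) 10)) (mulRat (npow U 6) 20 9)) (mulRat (npow T 5) 4 27)

/-- Inclusion for `eWinDer`. [folklore] -/
theorem mem_eWinDer {ST SU : ℤ} (hT : 0 < ST) (hU : 0 < SU) :
    FI.mem (27 / 2 * ((ST : ℝ) / SC)⁻¹ ^ 14 - 11 * ((SU : ℝ) / SC)⁻¹ ^ 13 + 25 / 9 * ((ST : ℝ) / SC)⁻¹ ^ 12 - 2 / 9 * ((SU : ℝ) / SC)⁻¹ ^ 11 -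
      27 / 2 * ((SU : ℝ) / SC)⁻¹ ^ 8 + 10 * ((ST : ℝ) / SC)⁻¹ ^ 7 - 20 / 9 * ((SU : ℝ) / SC)⁻¹ ^ 6 + 4 / 27 * ((ST : ℝ) / SC)⁻¹ ^ 5) (eWinDer ST SU) := by
  have hT' := mem_invPos (FI.mem_ofScaled ST) (by exact hT)
  have hU' := mem_invPos (FI.mem_ofScaled SU) (by exact hU)
  have a14 := mem_mulRat (mem_npow hT' 14) 27 (q := 2) (by norm_num)
  have a13 := FI.mem_mulInt (mem_npow hU' 13) 11
  have a12 := mem_mulRat (mem_npow hT' 12) 25 (q := 9) (by norm_num)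
  have a11 := mem_mulRat (mem_npow hU' 11) 2 (q := 9) (by norm_num)
  have a8 := mem_mulRat (mem_npow hU' 8) 27 (q := 2) (by norm_num)
  have a7 := FI.mem_mulInt (mem_npow hT' 7) 10
  have a6 := mem_mulRat (mem_npow hU' 6) 20 (q := 9) (by norm_num)
  have a5 := mem_mulRat (mem_npow hT' 5) 4 (q := 27) (by norm_num)
  have h := FI.mem_add (FI.mem_sub (FI.mem_add (FI.mem_sub (FI.mem_sub (FI.mem_add (FI.mem_sub a14 a13) a12) a11) a8) a7) a6) a5
  exact mem_congr h (by push_cast; ring)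

/-! ## §2. Square-root enclosure of the centre -/

/-- `lo := (FI.sqrt Q).lo/SC ≥ 0` and `lo² ≤ q` for `q ≥ 0`. [folklore] -/
theorem sqrtLo_nonneg_sq_le {q : ℝ} {Q : FI} (hq : FI.mem q Q) (h0 : 0 ≤ (FI.sqrt Q).lo) (hq0 : 0 ≤ q) :
    0 ≤ ((FI.sqrt Q).lo : ℝ) / SC ∧ (((FI.sqrt Q).lo : ℝ) / SC) ^ 2 ≤ q := by
  have h1 : ((FI.sqrt Q).lo : ℝ) / SC ≤ Real.sqrt q := FI.lo_div_le (FI.mem_sqrt hq)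
  have h0' : (0:ℝ) ≤ ((FI.sqrt Q).lo : ℝ) / SC := div_nonneg (by exact_mod_cast h0) SC_pos.le
  refine ⟨h0', ?_⟩
  calc (((FI.sqrt Q).lo : ℝ) / SC) ^ 2 ≤ Real.sqrt q ^ 2 := pow_le_pow_left₀ h0' h1 2
    _ = q := Real.sq_sqrt hq0

/-! ## §3. The value check -/

/-- Bump value pieces: `E1 ∋ V(q) − (3/200)E(q)`, `C ∋ −(3/200)·O(q)` (rational in `q`), `X1, X2 ∋ 5lo/4, 5hi/4`. -/
def eBumpE1 (Q : FI) : FI :=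
  let Z := mulRat Q 25 16
  FI.sub (eVq Q) (mulRat (FI.add (FI.sub (FI.ofInt 1) (mulRat Z 11 6)) (mulRat (npow Z 2) 33 16)) 3 200)

/-- `C ∋ −(3/200)·O(q)`, `O(q) = (25q/16)²·(−77/64 + (33/256)(25q/16) − (11/1024)(25q/16)² + (5/12288)(25q/16)³)`. -/
def eBumpC (Q : FI) : FI :=
  let Z := mulRat Q 25 16
  mulRat (FI.mul (npow Z 2) (FI.add (FI.sub (FI.add (FI.ofFrac (-77) 64) (mulRat Z 33 256)) (mulRat (npow Z 2) 11 1024))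
    (mulRat (npow Z 3) 5 12288))) (-3) 200

/-- Inclusion for `eBumpE1`. [folklore] -/
theorem mem_eBumpE1 {q : ℝ} {Q : FI} (hq : FI.mem q Q) (hQ : 0 < Q.lo) :
    FI.mem (1 / 12 * q⁻¹ ^ 6 - 1 / 6 * q⁻¹ ^ 3 - 3 / 200 * (1 - 11 / 6 * (25 * q / 16) + 33 / 16 * (25 * q / 16) ^ 2)) (eBumpE1 Q) := by
  have hZ := mem_mulRat hq 25 (q := 16) (by norm_num)
  have h1 := FI.mem_sub (FI.mem_ofInt 1) (mem_mulRat hZ 11 (q := 6) (by norm_num))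
  have h2 := FI.mem_add h1 (mem_mulRat (mem_npow hZ 2) 33 (q := 16) (by norm_num))
  have h := FI.mem_sub (mem_eVq hq hQ) (mem_mulRat h2 3 (q := 200) (by norm_num))
  exact mem_congr h (by push_cast; ring)

/-- Inclusion for `eBumpC`. [folklore] -/
theorem mem_eBumpC {q : ℝ} {Q : FI} (hq : FI.mem q Q) :
    FI.mem (-(3 / 200) * ((25 * q / 16) ^ 2 * (-(77 / 64) + 33 / 256 * (25 * q / 16) - 11 / 1024 * (25 * q / 16) ^ 2 +
      5 / 12288 * (25 * q / 16) ^ 3))) (eBumpC Q) := by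
  have hZ := mem_mulRat hq 25 (q := 16) (by norm_num)
  have c0 : FI.mem (-(77:ℝ) / 64) (FI.ofFrac (-77) 64) := mem_congr (FI.mem_ofFrac (-77) (q := 64) (by norm_num)) (by push_cast; ring)
  have h1 := FI.mem_add c0 (mem_mulRat hZ 33 (q := 256) (by norm_num))
  have h2 := FI.mem_sub h1 (mem_mulRat (mem_npow hZ 2) 11 (q := 1024) (by norm_num))
  have h3 := FI.mem_add h2 (mem_mulRat (mem_npow hZ 3) 5 (q := 12288) (by norm_num))
  have h4 := FI.mem_mul (mem_npow hZ 2) h3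
  have h := mem_mulRat h4 (-3) (q := 200) (by norm_num)
  exact mem_congr h (by push_cast; ring)

/-- ★ **THE VALUE CHECK** at the centre `q₀ = q0/SC` with hint `V` (scaled): certifies `V/SC ≤ φ(q₀)`. -/
def valLoOK (q0 V : ℤ) : Bool :=
  let Q := FI.ofScaled q0
  decide (0 < q0) &&
    (if 25 * q0 ≤ 64 * (SC : ℤ) then
      decide (0 ≤ (FI.sqrt Q).lo) && decide (0 ≤ (FI.sqrt Q).hi) &&
        decide (V ≤ (eBumpE1 Q).lo + min (FI.mul (eBumpC Q) (mulRat (FI.ofScaled (FI.sqrt Q).lo) 5 4)).lo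
          (FI.mul (eBumpC Q) (mulRat (FI.ofScaled (FI.sqrt Q).hi) 5 4)).lo)
    else if q0 ≤ 9 * (SC : ℤ) then decide (V ≤ (eVq Q).lo)
    else if 4 * q0 ≤ 81 * (SC : ℤ) then decide (0 ≤ (FI.sqrt Q).hi) && decide (V ≤ (eWinVal Q (FI.sqrt Q).hi).lo)
    else decide (V ≤ 0))

/-- ★★ **SOUNDNESS OF THE VALUE CHECK**: `valLoOK q0 V = true → V/SC ≤ φ(q0/SC)`. [folklore] -/
theorem valLoOK_sound {q0 V : ℤ} (h : valLoOK q0 V = true) :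
    (V : ℝ) / SC ≤ effPot w₄₅ ω₄ (3 / 400) (Real.sqrt ((q0 : ℝ) / SC)) := by
  have hq := FI.mem_ofScaled q0
  unfold valLoOK at h
  simp only [Bool.and_eq_true, decide_eq_true_eq] at h
  obtain ⟨hq0, h⟩ := h
  have hQ : 0 < (FI.ofScaled q0).lo := hq0
  have hpos : (0:ℝ) < (q0 : ℝ) / SC := div_pos (by exact_mod_cast hq0) SC_pos
  split_ifs at h with c1 c2 c3
  · -- bump
    simp only [Bool.and_eq_true, decide_eq_true_eq] at h
    obtain ⟨⟨hS1, hS2⟩, hV⟩ := h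
    set p₁ := (FI.mul (eBumpC (FI.ofScaled q0)) (mulRat (FI.ofScaled (FI.sqrt (FI.ofScaled q0)).lo) 5 4)).lo with hp₁
    set p₂ := (FI.mul (eBumpC (FI.ofScaled q0)) (mulRat (FI.ofScaled (FI.sqrt (FI.ofScaled q0)).hi) 5 4)).lo with hp₂
    have h64 : (q0 : ℝ) / SC ≤ 64 / 25 := div_SC_le_of (by norm_num) (by simpa using c1)
    obtain ⟨hlo0, hlo2⟩ := sqrtLo_nonneg_sq_le hq hS1 hpos.le
    obtain ⟨hhi2, hhi0⟩ := le_sqrtHi_sq hq hS2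
    have hC := mem_eBumpC hq
    have hP1 := FI.lo_div_le (FI.mem_mul hC (mem_mulRat (FI.mem_ofScaled (FI.sqrt (FI.ofScaled q0)).lo) 5 (q := 4) (by norm_num)))
    have hP2 := FI.lo_div_le (FI.mem_mul hC (mem_mulRat (FI.mem_ofScaled (FI.sqrt (FI.ofScaled q0)).hi) 5 (q := 4) (by norm_num)))
    rw [← hp₁] at hP1
    rw [← hp₂] at hP2
    have hm1 : ((min p₁ p₂ : ℤ) : ℝ) ≤ p₁ := by exact_mod_cast min_le_left p₁ p₂
    have hm2 : ((min p₁ p₂ : ℤ) : ℝ) ≤ p₂ := by exact_mod_cast min_le_right p₁ p₂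
    have hB1 : ((min p₁ p₂ : ℤ) : ℝ) / SC ≤
        -(3 / 200) * ((25 * ((q0 : ℝ) / SC) / 16) ^ 2 * (-(77 / 64) + 33 / 256 * (25 * ((q0 : ℝ) / SC) / 16) -
          11 / 1024 * (25 * ((q0 : ℝ) / SC) / 16) ^ 2 + 5 / 12288 * (25 * ((q0 : ℝ) / SC) / 16) ^ 3)) *
          (5 * (((FI.sqrt (FI.ofScaled q0)).lo : ℝ) / SC) / 4) :=
      (div_le_div_of_nonneg_right hm1 SC_pos.le).trans (hP1.trans (le_of_eq (by ring)))
    have hB2 : ((min p₁ p₂ : ℤ) : ℝ) / SC ≤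
        -(3 / 200) * ((25 * ((q0 : ℝ) / SC) / 16) ^ 2 * (-(77 / 64) + 33 / 256 * (25 * ((q0 : ℝ) / SC) / 16) -
          11 / 1024 * (25 * ((q0 : ℝ) / SC) / 16) ^ 2 + 5 / 12288 * (25 * ((q0 : ℝ) / SC) / 16) ^ 3)) *
          (5 * (((FI.sqrt (FI.ofScaled q0)).hi : ℝ) / SC) / 4) :=
      (div_le_div_of_nonneg_right hm2 SC_pos.le).trans (hP2.trans (le_of_eq (by ring)))
    have hmain := phi45_bump_ge_of_endpoints hpos.le h64 hlo0 hlo2 hhi0 hhi2 hB1 hB2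
    have hE1 := FI.lo_div_le (mem_eBumpE1 hq hQ)
    refine le_trans ?_ hmain
    have hV' : (V : ℝ) ≤ ((eBumpE1 (FI.ofScaled q0)).lo : ℝ) + ((min p₁ p₂ : ℤ) : ℝ) := by exact_mod_cast hV
    have := div_le_div_of_nonneg_right hV' SC_pos.le
    rw [add_div] at this
    linarith
  · -- LJ
    simp only [decide_eq_true_eq] at h
    have h64 : (64 : ℝ) / 25 ≤ (q0 : ℝ) / SC := by
      have : ¬ (25 * q0 ≤ 64 * (SC : ℤ)) := c1
      have h' : 64 * (SC : ℤ) ≤ 25 * q0 := by linarith [not_le.1 this]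
      exact le_div_SC_of (by norm_num) (by simpa using h')
    have h9 : (q0 : ℝ) / SC ≤ 9 := by
      have h' : (1:ℕ) * q0 ≤ 9 * (SC : ℤ) := by push_cast; linarith
      exact (div_SC_le_of (by norm_num) h').trans (by norm_num)
    rw [phi45_eq_lj h64 h9]
    exact le_trans (div_le_div_of_nonneg_right (by exact_mod_cast h) SC_pos.le) (FI.lo_div_le (mem_eVq hq hQ))
  · -- window
    simp only [Bool.and_eq_true, decide_eq_true_eq] at h
    obtain ⟨hS2, hV⟩ := h
    have h9 : (9 : ℝ) ≤ (q0 : ℝ) / SC := by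
      have : ¬ (q0 ≤ 9 * (SC : ℤ)) := c2
      have h' : 9 * (SC : ℤ) ≤ (1:ℕ) * q0 := by push_cast; linarith [not_le.1 this]
      exact le_trans (by norm_num) (le_div_SC_of (by norm_num) h')
    have h81 : (q0 : ℝ) / SC ≤ 81 / 4 := div_SC_le_of (by norm_num) (by simpa using c3)
    obtain ⟨hhi2, hhi0⟩ := le_sqrtHi_sq hq hS2
    have hmain := phi45_window_ge h9 h81 hhi0 hhi2
    refine le_trans ?_ hmain
    exact le_trans (div_le_div_of_nonneg_right (by exact_mod_cast hV) SC_pos.le) (FI.lo_div_le (mem_eWinVal hq hQ))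
  · -- far
    simp only [decide_eq_true_eq] at h
    have h81 : (81 : ℝ) / 4 ≤ (q0 : ℝ) / SC := by
      have : ¬ (4 * q0 ≤ 81 * (SC : ℤ)) := c3
      have h' : 81 * (SC : ℤ) ≤ 4 * q0 := by linarith [not_le.1 this]
      exact le_div_SC_of (by norm_num) (by simpa using h')
    rw [phi45_eq_far h81]
    have : (V : ℝ) ≤ 0 := by exact_mod_cast h
    exact div_nonpos_of_nonpos_of_nonneg this SC_pos.le

/-! ## §4. The derivative check -/

/-- Bump derivative pieces: `E2 ∋ G(q) − (3/256)E_R(q)` and `C' ∋ −(3/256)·O_R(q)` (both rational in `q`). -/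
def eBumpE2 (Q : FI) : FI :=
  let Z := mulRat Q 25 16
  FI.sub (eGlj Q) (mulRat (FI.add (FI.ofFrac (-11) 3) (mulRat Z 33 4)) 3 256)

/-- `C' ∋ −(3/256)·O_R(q)`, `O_R(q) = (25q/16)·(−385/64 + (231/256)(25q/16) − (99/1024)(25q/16)² + (55/12288)(25q/16)³)`. -/
def eBumpC2 (Q : FI) : FI :=
  let Z := mulRat Q 25 16
  mulRat (FI.mul Z (FI.add (FI.sub (FI.add (FI.ofFrac (-385) 64) (mulRat Z 231 256)) (mulRat (npow Z 2) 99 1024))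
    (mulRat (npow Z 3) 55 12288))) (-3) 256

/-- Inclusion for `eBumpE2`. [folklore] -/
theorem mem_eBumpE2 {q : ℝ} {Q : FI} (hq : FI.mem q Q) (hQ : 0 < Q.lo) :
    FI.mem (-(1 / 2) * q⁻¹ ^ 7 + 1 / 2 * q⁻¹ ^ 4 - 3 / 256 * (-(11 / 3) + 33 / 4 * (25 * q / 16))) (eBumpE2 Q) := by
  have hZ := mem_mulRat hq 25 (q := 16) (by norm_num)
  have c0 : FI.mem (-(11:ℝ) / 3) (FI.ofFrac (-11) 3) := mem_congr (FI.mem_ofFrac (-11) (q := 3) (by norm_num)) (by push_cast; ring)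
  have h1 := FI.mem_add c0 (mem_mulRat hZ 33 (q := 4) (by norm_num))
  have h := FI.mem_sub (mem_eGlj hq hQ) (mem_mulRat h1 3 (q := 256) (by norm_num))
  exact mem_congr h (by push_cast; ring)

/-- Inclusion for `eBumpC2`. [folklore] -/
theorem mem_eBumpC2 {q : ℝ} {Q : FI} (hq : FI.mem q Q) :
    FI.mem (-(3 / 256) * ((25 * q / 16) * (-(385 / 64) + 231 / 256 * (25 * q / 16) - 99 / 1024 * (25 * q / 16) ^ 2 +
      55 / 12288 * (25 * q / 16) ^ 3))) (eBumpC2 Q) := by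
  have hZ := mem_mulRat hq 25 (q := 16) (by norm_num)
  have c0 : FI.mem (-(385:ℝ) / 64) (FI.ofFrac (-385) 64) := mem_congr (FI.mem_ofFrac (-385) (q := 64) (by norm_num)) (by push_cast; ring)
  have h1 := FI.mem_add c0 (mem_mulRat hZ 231 (q := 256) (by norm_num))
  have h2 := FI.mem_sub h1 (mem_mulRat (mem_npow hZ 2) 99 (q := 1024) (by norm_num))
  have h3 := FI.mem_add h2 (mem_mulRat (mem_npow hZ 3) 55 (q := 12288) (by norm_num))
  have h4 := FI.mem_mul hZ h3
  have h := mem_mulRat h4 (-3) (q := 256) (by norm_num)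
  exact mem_congr h (by push_cast; ring)

/-- ★ **THE DERIVATIVE CHECK** at the centre `q₀ = q0/SC` with hints `Dlo, Dhi` (scaled): certifies `φ′(q₀) ∈ [Dlo/SC, Dhi/SC]`. -/
def derivOK (q0 Dlo Dhi : ℤ) : Bool :=
  let Q := FI.ofScaled q0
  decide (0 < q0) &&
    (if 25 * q0 ≤ 64 * (SC : ℤ) then
      let P1 := FI.mul (eBumpC2 Q) (mulRat (FI.ofScaled (FI.sqrt Q).lo) 5 4)
      let P2 := FI.mul (eBumpC2 Q) (mulRat (FI.ofScaled (FI.sqrt Q).hi) 5 4)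
      decide (0 ≤ (FI.sqrt Q).lo) && decide (0 ≤ (FI.sqrt Q).hi) &&
        decide (Dlo ≤ (eBumpE2 Q).lo + min P1.lo P2.lo) && decide ((eBumpE2 Q).hi + max P1.hi P2.hi ≤ Dhi)
    else if q0 ≤ 9 * (SC : ℤ) then decide (Dlo ≤ (eGlj Q).lo) && decide ((eGlj Q).hi ≤ Dhi)
    else if 4 * q0 ≤ 81 * (SC : ℤ) then
      decide (0 < (FI.sqrt Q).lo) && decide (0 ≤ (FI.sqrt Q).hi) &&
        decide (Dlo ≤ (eWinDer (FI.sqrt Q).hi (FI.sqrt Q).lo).lo) && decide ((eWinDer (FI.sqrt Q).lo (FI.sqrt Q).hi).hi ≤ Dhi)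
    else decide (Dlo ≤ 0) && decide (0 ≤ Dhi))

/-- ★★ **SOUNDNESS OF THE DERIVATIVE CHECK**: `derivOK q0 Dlo Dhi = true → φ′(q0/SC) ∈ Icc (Dlo/SC) (Dhi/SC)`. [folklore] -/
theorem derivOK_sound {q0 Dlo Dhi : ℤ} (h : derivOK q0 Dlo Dhi = true) :
    deriv (effPot w₄₅ ω₄ (3 / 400)) (Real.sqrt ((q0 : ℝ) / SC)) / (2 * Real.sqrt ((q0 : ℝ) / SC)) ∈ Icc ((Dlo : ℝ) / SC) ((Dhi : ℝ) / SC) := by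
  have hq := FI.mem_ofScaled q0
  unfold derivOK at h
  simp only [Bool.and_eq_true, decide_eq_true_eq] at h
  obtain ⟨hq0, h⟩ := h
  have hQ : 0 < (FI.ofScaled q0).lo := hq0
  have hpos : (0:ℝ) < (q0 : ℝ) / SC := div_pos (by exact_mod_cast hq0) SC_pos
  have hS := SC_pos
  split_ifs at h with c1 c2 c3
  · -- bump
    simp only [Bool.and_eq_true, decide_eq_true_eq] at h
    obtain ⟨⟨⟨hS1, hS2⟩, hL⟩, hU⟩ := h
    set P1 := FI.mul (eBumpC2 (FI.ofScaled q0)) (mulRat (FI.ofScaled (FI.sqrt (FI.ofScaled q0)).lo) 5 4) with hP1d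
    set P2 := FI.mul (eBumpC2 (FI.ofScaled q0)) (mulRat (FI.ofScaled (FI.sqrt (FI.ofScaled q0)).hi) 5 4) with hP2d
    have h64 : (q0 : ℝ) / SC ≤ 64 / 25 := div_SC_le_of (by norm_num) (by simpa using c1)
    obtain ⟨hlo0, hlo2⟩ := sqrtLo_nonneg_sq_le hq hS1 hpos.le
    obtain ⟨hhi2, hhi0⟩ := le_sqrtHi_sq hq hS2
    have hC := mem_eBumpC2 hq
    have hm1 := FI.mem_mul hC (mem_mulRat (FI.mem_ofScaled (FI.sqrt (FI.ofScaled q0)).lo) 5 (q := 4) (by norm_num))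
    have hm2 := FI.mem_mul hC (mem_mulRat (FI.mem_ofScaled (FI.sqrt (FI.ofScaled q0)).hi) 5 (q := 4) (by norm_num))
    rw [← hP1d] at hm1
    rw [← hP2d] at hm2
    have e1 : ∀ t : ℝ, -(3 / 256) * ((25 * ((q0 : ℝ) / SC) / 16) * (-(385 / 64) + 231 / 256 * (25 * ((q0 : ℝ) / SC) / 16) -
        99 / 1024 * (25 * ((q0 : ℝ) / SC) / 16) ^ 2 + 55 / 12288 * (25 * ((q0 : ℝ) / SC) / 16) ^ 3)) * ((5 : ℤ) / ((4 : ℕ) : ℝ) * t) =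
        -(3 / 256) * ((25 * ((q0 : ℝ) / SC) / 16) * (-(385 / 64) + 231 / 256 * (25 * ((q0 : ℝ) / SC) / 16) -
        99 / 1024 * (25 * ((q0 : ℝ) / SC) / 16) ^ 2 + 55 / 12288 * (25 * ((q0 : ℝ) / SC) / 16) ^ 3)) * (5 * t / 4) := by
      intro t; push_cast; ring
    rw [e1] at hm1 hm2
    have a1 := FI.lo_div_le hm1
    have a2 := FI.lo_div_le hm2
    have b1 := FI.le_hi_div hm1
    have b2 := FI.le_hi_div hm2
    have hmn1 : ((min P1.lo P2.lo : ℤ) : ℝ) ≤ P1.lo := by exact_mod_cast min_le_left _ _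
    have hmn2 : ((min P1.lo P2.lo : ℤ) : ℝ) ≤ P2.lo := by exact_mod_cast min_le_right _ _
    have hmx1 : (P1.hi : ℝ) ≤ ((max P1.hi P2.hi : ℤ) : ℝ) := by exact_mod_cast le_max_left _ _
    have hmx2 : (P2.hi : ℝ) ≤ ((max P1.hi P2.hi : ℤ) : ℝ) := by exact_mod_cast le_max_right _ _
    have hmain := dphi45_bump_mem_of_endpoints (Blo := ((min P1.lo P2.lo : ℤ) : ℝ) / SC) (Bhi := ((max P1.hi P2.hi : ℤ) : ℝ) / SC)
      hpos h64 hlo0 hlo2 hhi0 hhi2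
      ((div_le_div_of_nonneg_right hmn1 hS.le).trans a1) ((div_le_div_of_nonneg_right hmn2 hS.le).trans a2)
      (b1.trans (div_le_div_of_nonneg_right hmx1 hS.le)) (b2.trans (div_le_div_of_nonneg_right hmx2 hS.le))
    have hE2lo := FI.lo_div_le (mem_eBumpE2 hq hQ)
    have hE2hi := FI.le_hi_div (mem_eBumpE2 hq hQ)
    have hL' : (Dlo : ℝ) ≤ ((eBumpE2 (FI.ofScaled q0)).lo : ℝ) + ((min P1.lo P2.lo : ℤ) : ℝ) := by exact_mod_cast hL
    have hU' : ((eBumpE2 (FI.ofScaled q0)).hi : ℝ) + ((max P1.hi P2.hi : ℤ) : ℝ) ≤ Dhi := by exact_mod_cast hU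
    have hL'' := div_le_div_of_nonneg_right hL' hS.le
    have hU'' := div_le_div_of_nonneg_right hU' hS.le
    rw [add_div] at hL'' hU''
    exact ⟨by linarith [hmain.1], by linarith [hmain.2]⟩
  · -- LJ
    simp only [Bool.and_eq_true, decide_eq_true_eq] at h
    obtain ⟨hL, hU⟩ := h
    have h64 : (64 : ℝ) / 25 ≤ (q0 : ℝ) / SC := by
      have : ¬ (25 * q0 ≤ 64 * (SC : ℤ)) := c1
      have h' : 64 * (SC : ℤ) ≤ 25 * q0 := by linarith [not_le.1 this]
      exact le_div_SC_of (by norm_num) (by simpa using h')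
    have h9 : (q0 : ℝ) / SC ≤ 9 := by
      have h' : (1:ℕ) * q0 ≤ 9 * (SC : ℤ) := by push_cast; linarith
      exact (div_SC_le_of (by norm_num) h').trans (by norm_num)
    rw [dphi45_eq_lj h64 h9]
    have hm := mem_eGlj hq hQ
    exact ⟨le_trans (div_le_div_of_nonneg_right (by exact_mod_cast hL) hS.le) (FI.lo_div_le hm),
      le_trans (FI.le_hi_div hm) (div_le_div_of_nonneg_right (by exact_mod_cast hU) hS.le)⟩
  · -- window
    simp only [Bool.and_eq_true, decide_eq_true_eq] at h
    obtain ⟨⟨⟨hS1, hS2⟩, hL⟩, hU⟩ := h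
    have h9 : (9 : ℝ) ≤ (q0 : ℝ) / SC := by
      have : ¬ (q0 ≤ 9 * (SC : ℤ)) := c2
      have h' : 9 * (SC : ℤ) ≤ (1:ℕ) * q0 := by push_cast; linarith [not_le.1 this]
      exact le_trans (by norm_num) (le_div_SC_of (by norm_num) h')
    have h81 : (q0 : ℝ) / SC ≤ 81 / 4 := div_SC_le_of (by norm_num) (by simpa using c3)
    have hlo : (0:ℝ) < ((FI.sqrt (FI.ofScaled q0)).lo : ℝ) / SC := div_pos (by exact_mod_cast hS1) hS
    have hlo2 := sqrtLo_sq_le hq hS1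
    obtain ⟨hhi2, hhi0⟩ := le_sqrtHi_sq hq hS2
    have hS2' : 0 < (FI.sqrt (FI.ofScaled q0)).hi := by
      have : (((FI.sqrt (FI.ofScaled q0)).lo : ℝ) / SC) ^ 2 ≤ (((FI.sqrt (FI.ofScaled q0)).hi : ℝ) / SC) ^ 2 := hlo2.trans hhi2
      have h' := (pow_le_pow_iff_left₀ hlo.le hhi0 two_ne_zero).1 this
      have h'' : (0:ℝ) < ((FI.sqrt (FI.ofScaled q0)).hi : ℝ) / SC := hlo.trans_le h'
      have h3 : (0:ℝ) < ((FI.sqrt (FI.ofScaled q0)).hi : ℝ) := by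
        have := mul_pos h'' hS
        rwa [div_mul_cancel₀ _ hS.ne'] at this
      exact_mod_cast h3
    have hlow := dphi45_window_ge h9 h81 hlo hlo2 hhi0 hhi2
    have hupp := dphi45_window_le h9 h81 hlo hlo2 hhi0 hhi2
    have mL := FI.lo_div_le (mem_eWinDer hS2' hS1)
    have mU := FI.le_hi_div (mem_eWinDer hS1 hS2')
    exact ⟨le_trans (div_le_div_of_nonneg_right (by exact_mod_cast hL) hS.le) (mL.trans hlow),
      le_trans (hupp.trans mU) (div_le_div_of_nonneg_right (by exact_mod_cast hU) hS.le)⟩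
  · -- far
    simp only [Bool.and_eq_true, decide_eq_true_eq] at h
    obtain ⟨hL, hU⟩ := h
    have h81 : (81 : ℝ) / 4 ≤ (q0 : ℝ) / SC := by
      have : ¬ (4 * q0 ≤ 81 * (SC : ℤ)) := c3
      have h' : 81 * (SC : ℤ) ≤ 4 * q0 := by linarith [not_le.1 this]
      exact le_div_SC_of (by norm_num) (by simpa using h')
    rw [dphi45_eq_far h81]
    have hL' : (Dlo : ℝ) ≤ 0 := by exact_mod_cast hL
    have hU' : (0 : ℝ) ≤ Dhi := by exact_mod_cast hU
    exact ⟨div_nonpos_of_nonpos_of_nonneg hL' hS.le, div_nonneg hU' hS.le⟩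

/-! ## §5. Kernel smoke tests -/

/-- First-shell bump term at `q₀ = 0.95` (`r ≈ 0.9747`): the kernel certifies `φ(q₀) ≥ −0.1046` (true value ≈ −0.1046…; `W₄₅(0.9747) ≈ V + bump`). -/
example : valLoOK (95 * (SC : ℤ) / 100) (-(1046 * (SC : ℤ)) / 10000) = true := by decide +kernel

/-- … and the derivative there lies in `[−0.11, −0.09]` (`φ′(0.95) = −q⁻⁷/2 + q⁻⁴/2 − (3/256)R(5√q/4) ≈ −0.0994`). -/
example : derivOK (95 * (SC : ℤ) / 100) (-(11 * (SC : ℤ)) / 100) (-(9 * (SC : ℤ)) / 100) = true := by decide +kernel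

/-- … while a too-narrow enclosure is rejected. -/
example : derivOK (95 * (SC : ℤ) / 100) (-(2 * (SC : ℤ)) / 100) (8 * (SC : ℤ) / 100) = false := by decide +kernel

/-- A pure-LJ term at `q₀ = 3` (`φ = 3⁻⁶/12 − 3⁻³/6 ≈ −6.06·10⁻³`), a window term at `q₀ = 12` and a far term at `q₀ = 25`. -/
example : valLoOK (3 * (SC : ℤ)) (-(607 * (SC : ℤ)) / 100000) = true ∧ valLoOK (12 * (SC : ℤ)) (-(SC : ℤ) / 1000) = true ∧
    valLoOK (25 * (SC : ℤ)) 0 = true := by decide +kernel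

/-- Derivative enclosures for the same three terms. -/
example : derivOK (3 * (SC : ℤ)) (59 * (SC : ℤ) / 10000) (60 * (SC : ℤ) / 10000) = true ∧
    derivOK (12 * (SC : ℤ)) 0 (SC / 10000) = true ∧ derivOK (25 * (SC : ℤ)) 0 0 = true := by decide +kernel

end Summit.AtomisticToContinuum.Crystallization.Theorems.FrustratedLawDichotomyStrainedPatchHomTermEvalPoint
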